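import Summits.QuantumFields.YangMills.Theorems.BalabanUVNodesN15KingModelTorusPeriodisation
import Summits.QuantumFields.YangMills.Theorems.BalabanUVNodesN15KingModelBoxResolvent
import HarnessLib

/-!
# BalabanUVNodes ∕ N15 — THE KING-MODEL RUNG (PART Ε-c): THE DOUBLED-TORUS IMAGE SUM IS [Ba 4] (2.42)'s PRINTED IMAGE SERIES —
# `G^{Ω}(s,t) = Σ_{S⊆{0..d}} B⁻¹_{T(2n)}(s, σ_S t) = Σ_{(ε,m) ∈ Bool^{d+1}×ℤ^{d+1}} K_∞(s − σ_{ε,m} t) = Σ_{images w of t} K_∞(s − w)`, and this series is THE inverse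
# of [Ba 4]'s Neumann box operator `c(−Δ^N_□) + m²` (every link a tree theorem)
# (Track A, DAG node N15 = NE2; FAN-OUT v1.1 §N15 s3 «KING-MODEL RUNG»; King p.670 l.8–13 «Such representations are given explicitly in [Ba 4]» BY NAME; count-neutral)

HONEST FRAMING.  Count-neutral (cell `pub-ymgap`, seat `pub-ymgap-dag-n15-e` g40; `--supports stmt-QuantumFields-27366 --as helper` = K3⁸).
TEMPLATE LITERATURE: C. King, Commun. Math. Phys. **102** (1986) 649–677 [King1986], §4 p.670 l.8–13: «By using multiple reflection representations, the
propagators G^η_k and G^η_k(Ω) can be written in terms of the operator defined by (2.13) with free boundary conditions (and A = 0, of course), as long as Ω is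
a rectangular parallelepiped which is a union of blocks of L^k sites. Such representations are given explicitly in [Ba 4], so it is sufficient to prove
Propositions 3.8 and 3.9 for the operator with free boundary conditions»; T. Bałaban, Commun. Math. Phys. **89** (1983) 571–597 [Balaban1983RegularityDecay] = [Ba 4],
p.584 (2.42): «G_j(□; x, x′) = G_j(x, x′) + Σ_{μ=1}^d G_j(x, (x′_1,…,−x′_μ−ξ,…,x′_d)) + Σ_{μ=1}^d G_j(x, (x′_1,…,2M_μ−ξ−x′_μ,…,x′_d)) + …» (the image series over the
reflection group of the box; typed by the cell `pub-balaban` (pv17) in `Literature…B4Reflection242` as `(box N).imK G x x′ = Σ'_{w : fold w = x′} G x w` over a HYPOTHESIS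
kernel `G`, with the parametrisation `fibParam : Bool^{d+1} × ℤ^{d+1} ≃ fibre`, `reflBox N ε m`).  Part Ν (g39) of this lineage wrote King's box covariance with free
boundary conditions as the FINITE sum `kingBoxGreen n c m² s t = Σ_{S⊆{0..d}}(lapF (2n) c m²)⁻¹(dbl s, σ_S dbl t)` over the `2^{d+1}` images in the DOUBLED TORUS and proved
`(boxOp n c m²)⁻¹ = kingBoxGreen` (`boxOp_inv_apply`) — honestly flagged as «the periodized form of [Ba 4]'s series, a device of these files».  THIS FILE closes that
gap BY NAME: with part Ε-b (`lapF_inv_eq_tsum_freeKer`: each torus term is the periodisation `Σ_m K_∞(· + 2n·m)` of part Ε-a's free kernel) the `2^{d+1}` periodised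
terms regroup, image by image, into [Ba 4]'s series over ALL `(ε, m) ∈ Bool^{d+1} × ℤ^{d+1}`:
§1 `kingBoxZ s = (s_μ)_μ ∈ ℤ^{d+1}` (the box point as a lattice site; `kingBoxZ_mem_boxDom`, `foldBox_kingBoxZ`), the coordinate bookkeeping `torRepZ_dblBox`,
`torRepZ_torReflS_dblBox`, the relabelling `imageShift S : ℤ^{d+1} ≃ ℤ^{d+1}` (`m_μ ↦ 1 − m_μ` on `S`, `−m_μ` off `S`) with ★ `translate_imageDiff` (the `m`-th period
translate of `dbl s − σ_S dbl t` IS `s − σ_{1_S, imageShift S m} t`), and `setBoolEquiv : Finset (Fin (d+1)) ≃ (Fin (d+1) → Bool)`; §2 summability of the image family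
(`B4Reflection242.summable_norm_images` fed with Ε-a's decay) and ★★★ **`kingBoxGreen_eq_tsum_images`**: `kingBoxGreen n c m² s t = Σ'_{(ε,m)} K_∞(kingBoxZ s −
reflBox n ε m (kingBoxZ t))`; ★★★ **`kingBoxGreen_eq_imK`**: `= (B4Reflection242.box n _).imK (fun u w => K_∞(u − w)) (kingBoxZ s) (kingBoxZ t)` — [Ba 4] (2.42) AS PRINTED
(all terms), for the free covariance; ★★★ **`boxOp_inv_eq_imK`**: King's free-boundary box covariance `(boxOp n c m²)⁻¹(s,t)` (part Ν-a) IS that series.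
§3 THE SAME SERIES IS [Ba 4]'s OWN BOX PROPAGATOR: Ε-a's Green equation in pv17's kernel form ★ `freeKerC_green_opK` (`Σ_{z ∈ opSupp 1 x} opK c m² 0 1 x z · K_∞(z − x′) =
δ_{x,x′}` — [Ba 4] (2.44) with `a = 0`, via `B4Green242Bridge.sum_opSupp_opK_mul`) and its transpose, whence ★★★ **`neumannBox_imK_free`** = `B4Reflection242.greenBox_images₂`
INSTANTIATED: on every box `Π_μ[0,n_μ)` the image series of `K_∞` is the two-sided inverse of pv17's Neumann box operator `opBoxK c m² 0 1 n = c(−Δ^N_□) + m²` — hypothesis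
(i) (Green equation) and (iii) (decay) of that engine DISCHARGED by Ε-a, (ii) (reflection invariance) by the engine's own §7; and ★★ `neumannBox_inv_unique_free`
(`greenBox_unique`-style: any right inverse of `opBoxK` on the box is the image series).  So King's `boxOp⁻¹` (part Ν), the doubled-torus sum (part Ν), [Ba 4]'s
image series (2.42) and the inverse of [Ba 4]'s Neumann box operator (pv17) are ONE kernel.

PRIOR TREE ART (used by name, not restated): pv17 `B4Reflection242` (`box`, `imK`, `reflBox`, `fibParam`, `boxDom`, `opK`, `opBoxK`, `opSupp`, `summable_norm_images`,
`greenBox_images₂`, `green_right_of_symm`), `B4Green242Bridge.sum_opSupp_opK_mul`, part Ν-a∕a′ (`kingBoxGreen`, `boxOp_inv_apply`, `dblBox`, `torReflS`,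
`val_dblBox`, `val_mirror_dblBox`), parts Ε-a∕b.  NOT Bałaban's covariant `G_k(Ω, A)` (there is no image series at `U ≠ 1`); the `a ≠ 0` analogue (King's `G_k(Ω)`,
[Ba 4]'s `G_j(□)` with `a_jQ_j^*Q_j`) is the tree's `B4Green242Bridge` ∕ `B4Green244` lineage and is NOT re-done here; NOT a node discharge (N15 is booked through
n15-a's knit, untouched); nothing continuum-YM ∕ `ℝ⁴` ∕ OS ∕ Clay.  0 `sorry`; 3 `def` (`kingBoxZ`, `imageShift`, `setBoolEquiv`).

HONEST SCOPE.  `c ≥ 0`, `m² > 0`, any `d`, any box sides `n_μ ≥ 1`; identities plus absolute convergence (Ε-a's decay).  The dictionary `boxOp n c m² ↔ opBoxK c m² 0 1 n`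
between the two typings of the Neumann operator is obtained through their common inverse (§3), not entrywise.  Locators: [King1986] §4 p.670 l.8–13, (2.13) p.653,
(4.4) p.670; [Balaban1983RegularityDecay] (2.42)–(2.44) p.584.
-/

noncomputable section

open scoped BigOperators
open Finset Complex Matrix

namespace Summit.QuantumFields.YangMills.BalabanUVNodes.N15KingModelRung.TorusSpectral

open Literature.MathematicalPhysics.QuantumFieldTheory.Balaban1983to89.B5Prop11Plancherel (Tor unitVec)
open Literature.MathematicalPhysics.QuantumFieldTheory.Balaban1983to89.B4ContourShift (supNorm)
open Literature.MathematicalPhysics.QuantumFieldTheory.Balaban1983to89.B4Green244 (e)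
open Literature.MathematicalPhysics.QuantumFieldTheory.Balaban1983to89.B4TorusKernel.MultiPeriod (translate translate_apply torusSupNorm_nonneg)
open Literature.MathematicalPhysics.QuantumFieldTheory.Balaban1983to89.B4Reflection242 (box boxDom mem_boxDom mem_boxDom_iff_fold foldBox reflBox reflBox_apply
  refl1Fun fibParam fibParam_apply_coe summable_norm_images opK opBoxK opSupp greenBox_images₂ green_right_of_symm)
open Literature.MathematicalPhysics.QuantumFieldTheory.Balaban1983to89.B4Reflection242.ImageSystem (imK)
open Literature.MathematicalPhysics.QuantumFieldTheory.Balaban1983to89.B4Green242Bridge (sum_opSupp_opK_mul)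
open Literature.MathematicalPhysics.QuantumFieldTheory.King1986.Torus

variable {d : ℕ}

/-! ## §1 Box points as lattice sites; the image bookkeeping -/

section Bookkeeping

variable (n : Fin (d + 1) → ℕ) [hn : ∀ μ, NeZero (n μ)]

omit hn in
/-- The box point `s ∈ Π_μ{0,…,n_μ−1}` as a site of `ℤ^{d+1}`. [cite: Balaban1983RegularityDecay, (2.42) p.584 («□ = {x ∈ ξZ^d : 0 ≤ x_μ ≤ M_μ}»)] -/
def kingBoxZ (s : KingBox n) : Fin (d + 1) → ℤ := fun μ => ((s μ).val : ℤ)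

omit hn in
/-- `kingBoxZ s` lies in pv17's box `Π_μ[0, n_μ)`. [folklore] -/
theorem kingBoxZ_mem_boxDom (s : KingBox n) : kingBoxZ n s ∈ boxDom n :=
  mem_boxDom.2 fun μ => ⟨by simp [kingBoxZ], by simp [kingBoxZ]⟩

/-- `kingBoxZ s` is its own folded representative. [folklore] -/
theorem foldBox_kingBoxZ (s : KingBox n) : foldBox n (kingBoxZ n s) = kingBoxZ n s :=
  (mem_boxDom_iff_fold (fun μ => one_le_period n μ) _).1 (kingBoxZ_mem_boxDom n s)

omit hn in
/-- `kingBoxZ` is injective. [folklore] -/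
theorem kingBoxZ_injective : Function.Injective (kingBoxZ n) := by
  intro s t h; funext μ; exact Fin.ext (by have := congrFun h μ; simpa [kingBoxZ] using this)

omit hn in
/-- `torRepZ (dblBox s) = kingBoxZ s`. [folklore] -/
theorem torRepZ_dblBox (s : KingBox n) : torRepZ (dblPer n) (dblBox n s) = kingBoxZ n s := by
  funext μ; simp [torRepZ, kingBoxZ, val_dblBox]

/-- `torRepZ (σ_S(dblBox t))_μ = 2n_μ − 1 − t_μ` on `S`, `= t_μ` off `S`. [folklore] -/
theorem torRepZ_torReflS_dblBox (S : Finset (Fin (d + 1))) (t : KingBox n) (μ : Fin (d + 1)) :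
    torRepZ (dblPer n) (torReflS (dblPer n) S (dblBox n t)) μ = if μ ∈ S then 2 * (n μ : ℤ) - 1 - kingBoxZ n t μ else kingBoxZ n t μ := by
  unfold torRepZ kingBoxZ
  by_cases hμ : μ ∈ S
  · simp only [torReflS, hμ, if_true]
    rw [val_mirror_dblBox n t μ]
    have h1 : (t μ).val < n μ := (t μ).isLt
    have h2 : 1 ≤ n μ := one_le_period n μ
    omega
  · simp only [torReflS, hμ, if_false]
    rw [val_dblBox]

omit hn in
/-- THE RELABELLING OF THE PERIOD INDEX: `m_μ ↦ 1 − m_μ` on `S`, `m_μ ↦ −m_μ` off `S` (an involution of `ℤ^{d+1}`). [folklore] -/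
def imageShift (S : Finset (Fin (d + 1))) : (Fin (d + 1) → ℤ) ≃ (Fin (d + 1) → ℤ) where
  toFun m := fun μ => if μ ∈ S then 1 - m μ else -m μ
  invFun m := fun μ => if μ ∈ S then 1 - m μ else -m μ
  left_inv m := by funext μ; by_cases h : μ ∈ S <;> simp [h]
  right_inv m := by funext μ; by_cases h : μ ∈ S <;> simp [h]

/-- ★ IMAGE BY IMAGE: the `m`-th period translate (period `2n`) of `dbl s − σ_S dbl t` is `s − σ_{1_S, imageShift S m} t` — the doubled-torus image `S` periodised over
`2n·ℤ^{d+1}` runs through [Ba 4]'s images `(ε, m′)` with `ε = 1_S`. [cite: Balaban1983RegularityDecay, (2.42) p.584] -/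
theorem translate_imageDiff (S : Finset (Fin (d + 1))) (s t : KingBox n) (m : Fin (d + 1) → ℤ) :
    translate (dblPer n) (torRepZ (dblPer n) (dblBox n s) - torRepZ (dblPer n) (torReflS (dblPer n) S (dblBox n t))) (imageShift S m)
      = kingBoxZ n s - reflBox n (fun μ => decide (μ ∈ S)) m (kingBoxZ n t) := by
  funext μ
  rw [translate_apply, Pi.sub_apply, Pi.sub_apply, torRepZ_dblBox, torRepZ_torReflS_dblBox, reflBox_apply]
  unfold refl1Fun imageShift
  by_cases hμ : μ ∈ S
  · simp only [hμ, if_true, decide_true, Equiv.coe_fn_mk]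
    push_cast
    ring
  · simp only [hμ, if_false, decide_false, Equiv.coe_fn_mk, Bool.false_eq_true]
    push_cast
    ring

omit hn in
/-- subsets of the directions ↔ Boolean vectors. [folklore] -/
def setBoolEquiv : Finset (Fin (d + 1)) ≃ (Fin (d + 1) → Bool) where
  toFun S := fun μ => decide (μ ∈ S)
  invFun ε := Finset.univ.filter fun μ => ε μ = true
  left_inv S := by ext μ; simp
  right_inv ε := by funext μ; simp

end Bookkeeping

/-! ## §2 The doubled-torus image sum IS [Ba 4]'s image series -/

section Images

variable (n : Fin (d + 1) → ℕ) [hn : ∀ μ, NeZero (n μ)] {c m2 : ℝ}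

/-- SUMMABILITY OF [Ba 4]'s IMAGE FAMILY for the free kernel: `(ε, m) ↦ K_∞(z − σ_{ε,m} x′)` is absolutely summable (pv17's `summable_norm_images` fed with Ε-a's decay).
[cite: Balaban1983RegularityDecay, (2.42) p.584] -/
theorem summable_images_freeKer (hc : 0 ≤ c) (hm : 0 < m2) (z x' : Fin (d + 1) → ℤ) :
    Summable fun p : (Fin (d + 1) → Bool) × (Fin (d + 1) → ℤ) => freeKer c m2 (z - reflBox n p.1 p.2 x') := by
  have hN : ∀ i, 1 ≤ n i := one_le_period n
  have hK : ∀ u w : Fin (d + 1) → ℤ, ‖freeKerC c m2 (u - w)‖ ≤ 2 / m2 * Real.exp (-(kappaFree c m2 d * supNorm (u - w))) :=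
    fun u w => norm_freeKerC_le hc hm (u - w)
  obtain ⟨hs, _⟩ := summable_norm_images hN (K := fun u w => freeKerC c m2 (u - w)) (kappaFree_pos hc hm d) (by positivity) hK z x'
    (D := 0) (fun ε => torusSupNorm_nonneg (fun i => by linarith [hN i]) _)
  refine Summable.of_norm ?_
  refine hs.congr fun p => ?_
  rw [← ofReal_freeKer, Complex.norm_real]

/-- ★★★ **THE DOUBLED-TORUS IMAGE SUM IS [Ba 4] (2.42)'s IMAGE SERIES**: for every box `Ω = Π_μ{0,…,n_μ−1}`, `c ≥ 0`, `m² > 0`,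
`G^{Ω}(s,t) = Σ_{S⊆{0..d}} B⁻¹_{T(2n)}(dbl s, σ_S dbl t) = Σ_{(ε,m) ∈ Bool^{d+1} × ℤ^{d+1}} K_∞(s − σ_{ε,m} t)` — each torus term is the periodisation of `K_∞` (part Ε-b)
and the `2^{d+1}` periodised terms regroup image by image (`translate_imageDiff`). [cite: King1986, §4 p.670 l.8–13; Balaban1983RegularityDecay, (2.42) p.584] -/
theorem kingBoxGreen_eq_tsum_images (hc : 0 ≤ c) (hm : 0 < m2) (s t : KingBox n) :
    kingBoxGreen n c m2 s t
      = ∑' p : (Fin (d + 1) → Bool) × (Fin (d + 1) → ℤ), freeKer c m2 (kingBoxZ n s - reflBox n p.1 p.2 (kingBoxZ n t)) := by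
  have hsum := summable_images_freeKer n hc hm (kingBoxZ n s) (kingBoxZ n t)
  rw [hsum.tsum_prod' (fun ε => hsum.comp_injective (Prod.mk_right_injective ε)), tsum_fintype]
  unfold kingBoxGreen
  refine Fintype.sum_equiv (setBoolEquiv (d := d)) _ _ fun S => ?_
  rw [lapF_inv_eq_tsum_freeKer (dblPer n) hc hm, ← (imageShift S).tsum_eq]
  exact tsum_congr fun m => by rw [translate_imageDiff n S s t m]; rfl

/-- ★★★ **[Ba 4] (2.42) AS PRINTED, for the free covariance**: `G^{Ω}(s,t) = Σ_{w : fold w = t} K_∞(s − w)` — pv17's image kernel `imK` of the box image system over the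
translation-invariant kernel `K_∞(u − w)`, i.e. King p.670's «Such representations are given explicitly in [Ba 4]» BY NAME. [cite: King1986, §4 p.670 l.8–13;
Balaban1983RegularityDecay, (2.42) p.584] -/
theorem kingBoxGreen_eq_imK (hc : 0 ≤ c) (hm : 0 < m2) (s t : KingBox n) :
    kingBoxGreen n c m2 s t = (box n (one_le_period n)).imK (fun u w => freeKer c m2 (u - w)) (kingBoxZ n s) (kingBoxZ n t) := by
  rw [kingBoxGreen_eq_tsum_images n hc hm, imK, ← (fibParam (one_le_period n) (foldBox_kingBoxZ n t)).tsum_eq]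
  exact tsum_congr fun p => by rw [fibParam_apply_coe]

/-- ★★★ **KING's FREE-BOUNDARY BOX COVARIANCE IS [Ba 4]'s IMAGE SERIES**: `(c(−Δ_free) + m²)⁻¹(s,t) = Σ_{images w of t} K_∞(s − w)` (part Ν-a's `boxOp_inv_apply` + the above).
[cite: King1986, §4 p.670 l.8–13, (2.13) p.653; Balaban1983RegularityDecay, (2.42) p.584] -/
theorem boxOp_inv_eq_imK (hc : 0 ≤ c) (hm : 0 < m2) (s t : KingBox n) :
    (boxOp n c m2)⁻¹ s t = (box n (one_le_period n)).imK (fun u w => freeKer c m2 (u - w)) (kingBoxZ n s) (kingBoxZ n t) := by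
  rw [boxOp_inv_eq_kingBoxGreen n hc hm, kingBoxGreen_eq_imK n hc hm]

/-- The same with the image series written over `Bool^{d+1} × ℤ^{d+1}`. [cite: King1986, §4 p.670 l.8–13; Balaban1983RegularityDecay, (2.42) p.584] -/
theorem boxOp_inv_eq_tsum_images (hc : 0 ≤ c) (hm : 0 < m2) (s t : KingBox n) :
    (boxOp n c m2)⁻¹ s t = ∑' p : (Fin (d + 1) → Bool) × (Fin (d + 1) → ℤ), freeKer c m2 (kingBoxZ n s - reflBox n p.1 p.2 (kingBoxZ n t)) := by
  rw [boxOp_inv_eq_kingBoxGreen n hc hm, kingBoxGreen_eq_tsum_images n hc hm]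

end Images

/-! ## §3 The same series is the inverse of [Ba 4]'s Neumann box operator (pv17's `greenBox_images₂` instantiated) -/

section NeumannBox

variable {c m2 : ℝ}

/-- ★ **[Ba 4] (2.44) WITH `a = 0`, KERNEL FORM** (hypothesis (i) of pv17's images engine, DISCHARGED): for every `x, x′ ∈ ℤ^{d+1}`,
`Σ_{z ∈ opSupp 1 x} opK c m² 0 1 x z · K_∞(z − x′) = δ_{x,x′}` — Ε-a's Green equation read through `B4Green242Bridge.sum_opSupp_opK_mul`.
[cite: Balaban1983RegularityDecay, (2.44) p.584; King1986, (2.13) p.653] -/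
theorem freeKerC_green_opK (hc : 0 ≤ c) (hm : 0 < m2) (x x' : Fin (d + 1) → ℤ) :
    ∑ z ∈ opSupp 1 x, opK (c : ℂ) (m2 : ℂ) 0 1 x z * freeKerC c m2 (z - x') = if x = x' then 1 else 0 := by
  rw [sum_opSupp_opK_mul le_rfl, zero_mul, add_zero, add_comm]
  have h := freeKerC_green (d := d) hc hm (x - x')
  have e1 : ∀ μ, x + Pi.single μ 1 - x' = x - x' + e μ := fun μ => by unfold e; abel
  have e2 : ∀ μ, x - Pi.single μ 1 - x' = x - x' - e μ := fun μ => by unfold e; abel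
  simp_rw [e1, e2]
  rw [h]
  exact if_congr sub_eq_zero rfl rfl

/-- the transposed form (the kernel is symmetric since `K_∞` is even). [cite: Balaban1983RegularityDecay, (2.44) p.584] -/
theorem freeKerC_green_opK_right (hc : 0 ≤ c) (hm : 0 < m2) (x x' : Fin (d + 1) → ℤ) :
    ∑ z ∈ opSupp 1 x', freeKerC c m2 (x - z) * opK (c : ℂ) (m2 : ℂ) 0 1 z x' = if x = x' then 1 else 0 :=
  green_right_of_symm 1 (c : ℂ) (m2 : ℂ) 0 (G := fun u w => freeKerC c m2 (u - w)) (fun u w => by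
    show freeKerC c m2 (u - w) = freeKerC c m2 (w - u)
    rw [← freeKerC_neg, neg_sub]) (freeKerC_green_opK hc hm) x x'

/-- ★★★ **[Ba 4]'s NEUMANN BOX PROPAGATOR AT `a = 0` IS THE IMAGE SERIES OF `K_∞`** (pv17's `greenBox_images₂` with every hypothesis discharged): on every box
`Π_μ[0, n_μ)` (all `n_μ ≥ 1`), for `c ≥ 0`, `m² > 0`, the image-series matrix `(y, x′) ↦ Σ_{images w of x′} K_∞(y − w)` and the matrix of the Neumann box operator
`opBoxK c m² 0 1 n = c(−Δ^N_□) + m²` are TWO-SIDED inverses on `↥(boxDom n)`. [cite: Balaban1983RegularityDecay, (2.42), (2.44) p.584; King1986, §4 p.670 l.8–13] -/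
theorem neumannBox_imK_free (n : Fin (d + 1) → ℕ) (hn : ∀ i, 1 ≤ n i) (hc : 0 ≤ c) (hm : 0 < m2) :
    (Matrix.of fun x y : ↥(boxDom n) => opBoxK (c : ℂ) (m2 : ℂ) 0 1 n x.1 y.1)
        * (Matrix.of fun y x' : ↥(boxDom n) => (box n hn).imK (fun u w => freeKerC c m2 (u - w)) y.1 x'.1) = 1 ∧
      (Matrix.of fun y x' : ↥(boxDom n) => (box n hn).imK (fun u w => freeKerC c m2 (u - w)) y.1 x'.1)
        * (Matrix.of fun x y : ↥(boxDom n) => opBoxK (c : ℂ) (m2 : ℂ) 0 1 n x.1 y.1) = 1 :=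
  greenBox_images₂ hn le_rfl (fun i => one_dvd _) (c : ℂ) (m2 : ℂ) 0 (kappaFree_pos hc hm d) (by positivity : (0 : ℝ) ≤ 2 / m2)
    (fun u w => norm_freeKerC_le hc hm (u - w)) (freeKerC_green_opK hc hm) (freeKerC_green_opK_right hc hm)

/-- ★★ UNIQUENESS: any right inverse of pv17's Neumann box operator `c(−Δ^N_□) + m²` on the box is the image series of `K_∞`. [cite: Balaban1983RegularityDecay, (2.42) p.584] -/
theorem neumannBox_inv_unique_free (n : Fin (d + 1) → ℕ) (hn : ∀ i, 1 ≤ n i) (hc : 0 ≤ c) (hm : 0 < m2)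
    (GB : Matrix ↥(boxDom n) ↥(boxDom n) ℂ) (hGB : (Matrix.of fun x y : ↥(boxDom n) => opBoxK (c : ℂ) (m2 : ℂ) 0 1 n x.1 y.1) * GB = 1) :
    GB = Matrix.of fun y x' : ↥(boxDom n) => (box n hn).imK (fun u w => freeKerC c m2 (u - w)) y.1 x'.1 := by
  obtain ⟨_, h2⟩ := neumannBox_imK_free n hn hc hm
  calc GB = ((Matrix.of fun y x' : ↥(boxDom n) => (box n hn).imK (fun u w => freeKerC c m2 (u - w)) y.1 x'.1)
        * (Matrix.of fun x y : ↥(boxDom n) => opBoxK (c : ℂ) (m2 : ℂ) 0 1 n x.1 y.1)) * GB := by rw [h2, Matrix.one_mul]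
    _ = _ := by rw [Matrix.mul_assoc, hGB, Matrix.mul_one]

/-- The complex image series is the real one. [folklore] -/
theorem imK_freeKerC_eq_ofReal (n : Fin (d + 1) → ℕ) [∀ μ, NeZero (n μ)] (hc : 0 ≤ c) (hm : 0 < m2) (s t : KingBox n) :
    (box n (one_le_period n)).imK (fun u w => freeKerC c m2 (u - w)) (kingBoxZ n s) (kingBoxZ n t)
      = ((kingBoxGreen n c m2 s t : ℝ) : ℂ) := by
  rw [kingBoxGreen_eq_imK n hc hm, imK, imK, Complex.ofReal_tsum]
  exact tsum_congr fun w => (ofReal_freeKer c m2 _).symm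

/-- ★★★ **ONE KERNEL, FOUR NAMES**: on King's box, the `(kingBoxZ s, kingBoxZ t)` entry of THE inverse of pv17's Neumann box operator `c(−Δ^N_□)+m²` equals King's
`(boxOp n c m²)⁻¹(s,t)` (part Ν-a), the doubled-torus sum `kingBoxGreen` (part Ν-a), and [Ba 4]'s image series of `K_∞`.
[cite: King1986, §4 p.670 l.8–13; Balaban1983RegularityDecay, (2.42)–(2.44) p.584] -/
theorem neumannBox_inv_entry_eq_boxOp_inv (n : Fin (d + 1) → ℕ) [∀ μ, NeZero (n μ)] (hc : 0 ≤ c) (hm : 0 < m2)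
    (GB : Matrix ↥(boxDom n) ↥(boxDom n) ℂ) (hGB : (Matrix.of fun x y : ↥(boxDom n) => opBoxK (c : ℂ) (m2 : ℂ) 0 1 n x.1 y.1) * GB = 1) (s t : KingBox n) :
    GB ⟨kingBoxZ n s, kingBoxZ_mem_boxDom n s⟩ ⟨kingBoxZ n t, kingBoxZ_mem_boxDom n t⟩ = (((boxOp n c m2)⁻¹ s t : ℝ) : ℂ) := by
  rw [neumannBox_inv_unique_free n (one_le_period n) hc hm GB hGB, Matrix.of_apply, imK_freeKerC_eq_ofReal n hc hm, boxOp_inv_eq_kingBoxGreen n hc hm]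

end NeumannBox

end Summit.QuantumFields.YangMills.BalabanUVNodes.N15KingModelRung.TorusSpectral

end
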